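import Mathlib
import Summits.PneNP.PneNP.Theorems.Nc03AvoidResidualCoreReductionRankKit

/-!
# Route Nc03AvoidResidualCore, item `CandStarReduction` (★) — the tangled-surplus solver, I: the program

Helper file for `stmt-PneNP-19963` (cell pnp-ideate; registered stub `stub_cherryStar :
TangledSurplusFP` of the birth skeleton Cruxes/CandStarReduction/Lines/birth.lean). The ★-solver of
the cell memo pnp-ideate-p2/ROUND-3-ADDENDUM-B Thm B.1 in a ROOT-FREE form (no BFS / spanning trees):
program-level definitions on raw pure instances `pr = (N, M, triples)` (`Nc03Reduction.PRaw`), all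
plain list functions, whose polynomial-time typing (`CodeFP`) and correctness are proved in the sequels.

The algorithm (input: a pure `CAND` instance, outputs `y_o = x_{c_o} ⊕ (x_{a_o} ∧ x_{b_o})`):
* `apexB c u`: variable `u` is a data endpoint (roles `1,2`) of at least two outputs of head `c`;
* FORCED variables `forcedB u`: some output `o = (c; u, w)` (or `(c; w, u)`) with `u` an apex of
  `c` and `w < u ∨ ¬ apexB c w`; the first such output is `par u` (`parOf`), and the first OTHER
  output of head `c` containing `u` as a datum is `ep u` (`epOf`); the pair `(par u, ep u)` is the
  CHERRY of `u` (`cherryOf`, `cherries`). A target separating a cherry forces `x_u = 1` (F2).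
  The rule `w < u ∨ ¬apex` makes the map `par u ↦ ep u` (`pNext`) ACYCLIC (the apex index increases
  along it) — this replaces the memo's BFS forcing forest — while every tangled output still has a
  forced endpoint (coverage);
* `chain o`: follow `pNext` for `M` steps from `o`, recording the endpoint `root o` and the parity
  `col o` of the number of moves; `col` solves the cherry system `y_{par u} ≠ y_{ep u}`, and
  flipping `col` on one class `{root = r}` keeps it solved;
* once the forced variables are `1`, every covered tangled output (`covB`) is AFFINE:
  `y_o ⊕ β_o = Σ_{v ∈ U_o} x_v` (`betaB`, `colP`); candidate `k` (`k = 0`: no flip; `k = t + 1`: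
  flip the class of `t`) is the pattern `yB k = covB ∧ (col ⊕ flip)`; it is CERTIFIED if it
  separates every cherry (`consOK`) and `y ⊕ β` restricted to the covered tangled outputs is NOT in
  the span of the columns `colV v` (the span test `Nc03Reduction.inSpan`, by rank); the solver
  outputs the first certified candidate (`solStar`). Soundness of a certificate is elementary;
  existence (some `k ≤ M` is certified when `#tangled ≥ N + 1`) is the dimension count of Thm B.1.

Restricted-model (NC⁰₃) range-avoidance rung F-N1b of the PneNP frontier ladder (an algorithmic
reduction between two restricted AVOID problems); nothing here bears on P vs NP.
-/

set_option linter.dupNamespace false -- `Summit.PneNP.PneNP.…`: summit = sub-problem name (D-0017 single-conjunct layout)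

namespace Summit.PneNP.PneNP.Theorems.Nc03CandStarRF

open Literature.Computability.Complexity
open Summit.PneNP.PneNP.Theorems.Nc03Reduction (PRaw ETrip enumT inSpan indic searchOut)

/-! ## Apexes, tangled outputs, forced variables, cherries -/

/-- `u` is a data endpoint (role `1` or `2`) of the variable triple `t = (c, a, b)`. -/
def isData (t : ℕ × ℕ × ℕ) (u : ℕ) : Bool := decide (u = t.2.1) || decide (u = t.2.2)

/-- The other data endpoint of `t` (given that `u` is one). -/
def othD (t : ℕ × ℕ × ℕ) (u : ℕ) : ℕ := if u = t.2.1 then t.2.2 else t.2.1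

/-- `u` is an APEX of head `c`: two distinct outputs of head `c` have `u` as a data endpoint. -/
def apexB (pr : PRaw) (c u : ℕ) : Bool :=
  (enumT pr).any fun e => (enumT pr).any fun e' =>
    !decide (e.1 = e'.1) && decide (e.2.1 = c) && decide (e'.2.1 = c) && isData e.2 u && isData e'.2 u

/-- The enumerated output `e = (o, (c, a, b))` is TANGLED: another output with the same head shares a
data endpoint with it (program form of `…Nc03AvoidResidualCoreCandCherry.tangled`). -/
def tangB (pr : PRaw) (e : ETrip) : Bool :=
  (enumT pr).any fun e' => !decide (e'.1 = e.1) && decide (e'.2.1 = e.2.1) &&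
    (isData e'.2 e.2.2.1 || isData e'.2 e.2.2.2)

/-- Output `e` WITNESSES that `u` is forceable: `u` is a data endpoint of `e` and an apex of its head,
and the other data endpoint is smaller than `u` or is not an apex of that head. -/
def forceW (pr : PRaw) (u : ℕ) (e : ETrip) : Bool :=
  isData e.2 u && apexB pr e.2.1 u && (decide (othD e.2 u < u) || !apexB pr e.2.1 (othD e.2 u))

/-- The PARENT output of `u`: the first witness. -/
def parOf (pr : PRaw) (u : ℕ) : Option ETrip := (enumT pr).find? (forceW pr u)

/-- `u` is FORCED: it has a parent output. -/
def forcedB (pr : PRaw) (u : ℕ) : Bool := (parOf pr u).isSome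

/-- The second cherry output of `u` relative to the output `e`: the first OTHER output with the same
head having `u` as a data endpoint. -/
def epOf (pr : PRaw) (u : ℕ) (e : ETrip) : Option ETrip :=
  (enumT pr).find? fun e' => !decide (e'.1 = e.1) && decide (e'.2.1 = e.2.1) && isData e'.2 u

/-- The CHERRY of `u`: `(u, par u, ep u)`, if `u` is forced. -/
def cherryOf (pr : PRaw) (u : ℕ) : Option (ℕ × ETrip × ETrip) :=
  (parOf pr u).bind fun e => (epOf pr u e).map fun e' => (u, e, e')

/-- All cherries, listed along the variables `u < N`. -/
def cherries (pr : PRaw) : List (ℕ × ETrip × ETrip) :=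
  ((List.range pr.1).map fun u => (cherryOf pr u).toList).flatten

/-! ## Chains: roots and colours -/

/-- The successor of output `o` along the cherries: `par u ↦ ep u`. -/
def pNext (pr : PRaw) (o : ℕ) : Option ℕ :=
  ((cherries pr).find? fun q => decide (q.2.1.1 = o)).map fun q => q.2.2.1

/-- One chain step: move to the successor and flip the colour, or stay. -/
def chainStep (pr : PRaw) (s : ℕ × Bool) : ℕ × Bool :=
  match pNext pr s.1 with
  | none => s
  | some o' => (o', !s.2)

/-- The chain of `o`: `M` steps from `(o, false)`; its components are the ROOT and the COLOUR of `o`. -/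
def chain (pr : PRaw) (o : ℕ) : ℕ × Bool := (chainStep pr)^[pr.2.1] (o, false)

/-! ## Candidates and the certificate -/

/-- COVERED tangled output: tangled, with a forced data endpoint. -/
def covB (pr : PRaw) (e : ETrip) : Bool := tangB pr e && (forcedB pr e.2.2.1 || forcedB pr e.2.2.2)

/-- Candidate `k` flips the chain class of output `k - 1` (no flip for `k = 0`). -/
def flipB (pr : PRaw) (k o : ℕ) : Bool := !decide (k = 0) && decide ((chain pr o).1 = (chain pr (k - 1)).1)

/-- The bit of candidate pattern `k` at the enumerated output `e`. -/
def yB (pr : PRaw) (k : ℕ) (e : ETrip) : Bool := covB pr e && xor (chain pr e.1).2 (flipB pr k e.1)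

/-- The affine constant `β_o` of a covered output once the forced variables are `1`. -/
def betaB (pr : PRaw) (t : ℕ × ℕ × ℕ) : Bool := xor (forcedB pr t.1) (forcedB pr t.2.1 && forcedB pr t.2.2)

/-- Variable `v` occurs in the affine form of the output with triple `t` (forced variables are constants). -/
def colP (pr : PRaw) (v : ℕ) (t : ℕ × ℕ × ℕ) : Bool :=
  (decide (v = t.1) && !forcedB pr t.1) || (decide (v = t.2.2) && forcedB pr t.2.1 && !forcedB pr t.2.2) ||
    (decide (v = t.2.1) && forcedB pr t.2.2 && !forcedB pr t.2.1)

/-- The column of variable `v`: the covered tangled outputs in whose affine form `v` occurs. -/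
def colV (pr : PRaw) (v : ℕ) : List ℕ := ((enumT pr).filter fun e => covB pr e && colP pr v e.2).map Prod.fst

/-- All columns, `v < N`. -/
def cols (pr : PRaw) : List (List ℕ) := (List.range pr.1).map (colV pr)

/-- The support of candidate pattern `k`. -/
def ySet (pr : PRaw) (k : ℕ) : List ℕ := ((enumT pr).filter (yB pr k)).map Prod.fst

/-- The support of `y ⊕ β` on the covered tangled outputs, for candidate `k`. -/
def tgt (pr : PRaw) (k : ℕ) : List ℕ :=
  ((enumT pr).filter fun e => xor (yB pr k e) (covB pr e && betaB pr e.2)).map Prod.fst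

/-- Candidate `k` separates every cherry. -/
def consOK (pr : PRaw) (k : ℕ) : Bool := (cherries pr).all fun q => xor (yB pr k q.2.1) (yB pr k q.2.2)

/-- THE CERTIFICATE TEST for candidate `k`: it separates every cherry and `y ⊕ β` is not in the span
of the columns. -/
def testC (pr : PRaw) (k : ℕ) : Bool := consOK pr k && !inSpan pr.2.1 (cols pr) (tgt pr k)

/-- **The ★-solver**: the indicator of the support of the first certified candidate `k ≤ M`. -/
def solStar (pr : PRaw) : List Bool := searchOut pr.2.1 (((List.range (pr.2.1 + 1)).find? (testC pr)).map (ySet pr))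

/-- The ★-solver outputs `M` bits. -/
@[simp] theorem length_solStar (pr : PRaw) : (solStar pr).length = pr.2.1 := by
  unfold solStar; simp

end Summit.PneNP.PneNP.Theorems.Nc03CandStarRF
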